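/-
Copyright (c) 2026 the pub-hodgecm-mathlib formalisation cell (harness21).  Prover seat hodgecm-mathlib-A-p12 (g24), 2026-09-02.  «S3-ram» seeding wave (LEAD F0P3a-plan (g12)
T11-80∕T11-84; owner F0P3a-p06 (g15)): organ (B-i) «DEPTH-REFINED FIXED BALLS» of the (α₂) TYPE-(2) line (F0P3a-p07 (g13) ledger v1.3 §2: the `m⁰(N−2j)` inputs of `stub_T2G_zero` ∕
`stub_T2G_pm`), in the coset currency of ★ FILE C (p847245).  Kernel lane, `--supports stmt-HodgeConjecture-24833`.
-/
import Literature.NumberTheory.Rogawski1990.DepthZeroKappaTransferTypeTwoRamifiedHSide   -- ★ p847245 (this lineage, g23) FILE C: counts `(m♯, m⁰)` of a deep type-(2) `γ₂`; ⊇ FILE A∕B, ★ p847070, (W1) descent, ★ p847118 parity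
import Literature.NumberTheory.Automorphic.UnitaryTwoTreeActionDescent                 -- ★ B-p08: the unitary LIFT `diag(1,α)⁻¹ (s ι(g)) diag(1,α) ∈ U(Φ₂)` when `σ(s) s ι(det g) = 1`
import Literature.RingTheory.DiscreteValuationRing.AdicCompletionHensel                 -- ★ `adicCompletionIntegers.henselianLocalRing` (square roots of one-units)
import HarnessLib

/-!
# Depth-refined fixed balls of a type-(2) element at a tame-ramified place, I — THE RESCALING: the self-dual lattices on which `γ_W − ½tr γ_W` is `ϖ_v^j`-divisible are
# the fixed lattices of a RESCALED unitary element of discriminant depth `2(N − 2j)` (Labesse–Langlands 1979 §2; Kottwitz 1988 §2; Rogawski 1990 §4.9)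

Topic `NumberTheory/Rogawski1990`; namespace `Literature.NumberTheory.Automorphic.UnitaryGroup`.  THEOREMS ONLY (no definition, no instance, no notation, no named fact,
no `sorry`); kernel lane `--supports stmt-HodgeConjecture-24833`.  Cell `pub/hodgecm-mathlib` (D-0151), crux H413; «S3-ram» seeding wave (count-neutral); seat A-p12 (g24),
heir-architect of the (α₂) line, organ (B-i) of the (d-v-dict) lane (F0P3a-p07 (g13) memo v1.3 «ASSEMBLY LEDGER» §2: the inner balls `m⁰(N−2)`, `m⁰(N−4)` of law (S-0)
∕ (L2); F0P3a-p02 (g17) ORGAN 3).  HONEST LABEL: HC_CM is proved only modulo the cell's 2 remaining named inputs (hLiu418 24832, h413 24833) until rung 0 closes; nothing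
printed is asserted here — `2 × 2` algebra, Hensel's lemma and an assembly of ★ counts.

THE MATHEMATICS (the RESCALING TRICK).  `L` CM, `v` a finite place of `L⁺` TAME-RAMIFIED in `L` (`e(w|v) ≠ 1`, `2 ∈ 𝒪_w^×`), `w ∣ v`, `ϖ` the anti-fixed uniformiser of `L_w`
(`σ_w ϖ = −ϖ`), `ϖ_F` a uniformiser of `L⁺_v` (`|ι ϖ_F|_w = |ϖ|_w²`), `U₂ = U(Φ₂)(L⁺_v) ≃ U(σ_w, Φ₂)(L_w)` (★ `localNonsplitEquiv`, written `E₂`), `K⁰ = U(Φ₂)(𝒪_v) ↔ GL₂(𝒪_w)`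
(stabiliser of the self-dual lattice `𝒪_w²` = an EDGE of the tree of `SL₂(L⁺_v)`), `C′ ↔ D_ϖ GL₂(𝒪_w) D_ϖ⁻¹` (a `ϖ`-modular VERTEX).  Let `γ₂ ∈ U₂` be of TYPE (2) (`χ_{γ₂,w}` has no
root in `L_w`) with `|tr² − 4 det|_w(γ_{2,w}) = exp(−2·2n)` (even discriminant depth; the unramified-elliptic descent `γ_{2,w} = D_ϖ⁻¹ (s·ι g) D_ϖ`, `tr g = t ≠ 0`,
`tr²g − 4det g = ε₀ z²`, `|z∕t| = |ϖ_F|ⁿ`, ★ p847118), and put `c := ½ tr γ_{2,w} = s·ι(t∕2)` (a unit).  For `0 ≤ j < n` the RESCALED element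
  `γ₂^{(j)} := λ_j⁻¹ · (1 + (2 ϖ_F^{−j} ∕ t)·s⁻¹·(γ_{2,w} − c·1)) = D_ϖ⁻¹ (λ_j⁻¹ · ι g_j) D_ϖ`,  `g_j := 1 + (2ϖ_F^{−j}∕t)(g − ½t)`,  `λ_j² = det g_j = 1 − ε₀(zϖ_F^{−j}∕t)²`
(`λ_j ∈ L⁺_v` a one-unit, Hensel) lies in `U₂` (§2: ★ unitary lift, `σ(λ⁻¹)λ⁻¹ι(det g_j) = 1`), is again of type (2) with the unramified-elliptic datum `(2, det g_j, 2zϖ_F^{−j}∕t, ε₀,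
n − j)` — discriminant depth `2·2(n−j)` — and for every `h ∈ U₂`:
  **`h⁻¹ γ₂^{(j)} h ∈ K⁰  ⟺  |(E₂(h⁻¹γ₂h) − c·1)_{ab}|_w ≤ |ϖ|_w^{2j}` for all `a, b`**  (§1: `h⁻¹γ₂^{(j)}h = λ_j⁻¹·1 + k·(E₂(h⁻¹γ₂h) − c·1)` with `|k|_w = |ϖ|_w^{−2j}`, and
`|det|_w = 1`), i.e. the `γ₂`-FIXED SELF-DUAL LATTICES `B = h·𝒪_w²` ON WHICH `γ_W − c` IS `ϖ_F^j`-DIVISIBLE (`(γ_W − c)B ⊆ ϖ^{2j}B`; these depths are odd, so `⊆ ϖ^{2j+1}B` is the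
same condition) ARE EXACTLY THE FIXED SELF-DUAL LATTICES OF `γ₂^{(j)}`, and likewise for the `ϖ`-modular column with `D_ϖ`-twisted entries.  Hence, by ★ FILE C at depth
`2·2(n−j)` (★ FILE B `sub_one_mul_natCard_fixedBy_add_two_eq_of_unramified_elliptic` = ★ p847070, and ★ FILE A `#K⁰ + 1 = #K♯`):
  **`#{hK⁰ : |(E₂(h⁻¹γ₂h) − c·1)_{ab}|_w ≤ |ϖ|_w^{2j}} = (q+1)·Σ_(k<n−j) q^k = m⁰(2(n−j))`**,  **`#{hC′ : …D_ϖ-twisted…} = 1 + (q+1)·Σ_(k<n−j) q^k = m♯(2(n−j))`**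
— the vertex ball of radius `n − j` [LabesseLanglands1979, §2 Lemma 2.1].  These are the «inner balls» of F0P3a-p07 (g13)'s law (S-0)∕(L2) (`j = 1`: the label-`0` axis
vertices `m⁰(N−2)`; `j = 2`: hair (3,1), `m⁰(N−4)`), now theorems in the junction currency of ★ FILE C (the axis `{B}` of the t₀ literal is `Fix(U(W) ⧸ K⁰)` by ★ (hA)
`forall_isSelfDualLattice_exists_latt_eq_of_ramified` + ★ `exists_equiv_fixedBy_fixed_selfDual_apply`); the TREE IDENTITY `m⁰(N) = (q+1)m⁰(N−2) − q·m⁰(N−4)` is the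
geometric-sum recursion (§4).  No deepness of `γ₂` is assumed (the statement is conjugation-invariant); `1 ≤ n` follows from `j < n`.

* §1 (any fields `ι : F → E`, `σ`, `α`) `trace_det_disc_one_add_smul_sub` (the datum of `g_j`), `eq_smul_one_add_smul_of_descents` (the affine identity
  `u′ = s′·1 + (s′ιμ s⁻¹)·(u − sι(t∕2)·1)` from the two descents), `conj_affine` (conjugation commutes with it), `isRoot_charpoly_of_affine` (roots transport), `forall_v_le_one_affine_iff`
  (integrality of `s′·1 + k·N` ⟺ `|N_{ab}| ≤ |k|⁻¹` when `|s′| ≤ 1`), `charpoly_separable_of_disc_ne_zero`.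
* §2 (place level) **`exists_rescaled_descent_of_elliptic`** (the element `γ₂^{(j)} ∈ U_w` with its descent,
  datum and affine identity).
* The COUNTS themselves (the `cmDatum` currency of ★ FILE C, `natCard_depthFixed_selfDual_and_modular_of_even_depth_ramified`) and the tree identity are the sequel file
  `DepthZeroKappaTransferTypeTwoRamifiedDepthBalls.lean` (this file is its engine: §1–§2 only, both parities).

## References
* [LabesseLanglands1979] J.-P. Labesse, R. P. Langlands, *L-indistinguishability for SL(2)*, Canad. J. Math. 31 (1979): §2 Lemma 2.1 p. 8 (fixed balls of elliptic tori).
* [Kottwitz1988] R. E. Kottwitz, *Tamagawa numbers*, Ann. of Math. 127 (1988): §2 (fixed points on the building; orbit–stabiliser).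
* [Rogawski1990] J. D. Rogawski, *Automorphic Representations of Unitary Groups in Three Variables*, Ann. of Math. Stud. 123 (1990): §4.9 Lemma 4.9.3 p. 56, Prop. 4.9.1 p. 55.
* [Serre1979] J.-P. Serre, *Local Fields*, GTM 67 (1979): Ch. II §4 Prop. 7 (Hensel), Ch. XIV §4.
-/

set_option autoImplicit false

noncomputable section

open MeasureTheory Measure Set NumberField IsDedekindDomain Matrix ValuativeRel MulAction Finset Polynomial
open scoped ValuativeRel Matrix MatrixGroups WithZero

namespace Literature.NumberTheory.Automorphic.UnitaryGroup

open Literature.NumberTheory.Rogawski1990 Literature.NumberTheory.Automorphic Literature.NumberTheory.Automorphic.IntegralReduction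
open Literature.NumberTheory.Automorphic.HermitianLatticeTree Literature.GroupTheory Literature.NumberTheory.GaloisRepresentations

/-! ## §1 `2 × 2` algebra: the rescaled datum, the affine identity, roots and integrality -/

section Algebra

variable {F E : Type*} [Field F] [Field E] (ι : F →+* E)

omit ι in
/-- **THE RESCALED DATUM**: for `g` with `tr g = t`, `det g = d`, `t² − 4d = ε₀z²` (and `2 ≠ 0`), the matrix `g_μ := 1 + μ·(g − ½t·1)` has `tr g_μ = 2`,
`det g_μ = 1 − ε₀(μz∕2)²` and `tr² g_μ − 4 det g_μ = ε₀(μz)²` (Cayley–Hamilton: `(g − ½t)² = ¼(t² − 4d)`). [cite: LabesseLanglands1979, §2 p. 7] -/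
theorem trace_det_disc_one_add_smul_sub (h2 : (2 : F) ≠ 0) (g : Matrix (Fin 2) (Fin 2) F) {t d ε₀ z : F} (htr : g.trace = t) (hdet : g.det = d)
    (hD : t ^ 2 - 4 * d = ε₀ * z ^ 2) (μ : F) :
    (1 + μ • (g - (t / 2) • (1 : Matrix (Fin 2) (Fin 2) F))).trace = 2 ∧
      (1 + μ • (g - (t / 2) • (1 : Matrix (Fin 2) (Fin 2) F))).det = 1 - ε₀ * (μ * z / 2) ^ 2 ∧
      (1 + μ • (g - (t / 2) • (1 : Matrix (Fin 2) (Fin 2) F))).trace ^ 2 - 4 * (1 + μ • (g - (t / 2) • (1 : Matrix (Fin 2) (Fin 2) F))).det = ε₀ * (μ * z) ^ 2 := by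
  rw [Matrix.trace_fin_two] at htr
  rw [Matrix.det_fin_two] at hdet
  set ν : F := (2 : F)⁻¹ with hνdef
  have hν : ν * 2 = 1 := inv_mul_cancel₀ h2
  have hdiv : ∀ x : F, x / 2 = x * ν := fun x => div_eq_mul_inv x 2
  simp only [hdiv]
  have e00 : (1 + μ • (g - (t * ν) • (1 : Matrix (Fin 2) (Fin 2) F))) 0 0 = 1 + μ * (g 0 0 - t * ν) := by simp
  have e11 : (1 + μ • (g - (t * ν) • (1 : Matrix (Fin 2) (Fin 2) F))) 1 1 = 1 + μ * (g 1 1 - t * ν) := by simp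
  have e01 : (1 + μ • (g - (t * ν) • (1 : Matrix (Fin 2) (Fin 2) F))) 0 1 = μ * g 0 1 := by simp
  have e10 : (1 + μ • (g - (t * ν) • (1 : Matrix (Fin 2) (Fin 2) F))) 1 0 = μ * g 1 0 := by simp
  have htr' : (1 + μ • (g - (t * ν) • (1 : Matrix (Fin 2) (Fin 2) F))).trace = 2 := by
    rw [Matrix.trace_fin_two, e00, e11]
    linear_combination μ * htr - μ * t * hν
  have hdet' : (1 + μ • (g - (t * ν) • (1 : Matrix (Fin 2) (Fin 2) F))).det = 1 - ε₀ * (μ * z * ν) ^ 2 := by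
    rw [Matrix.det_fin_two, e00, e11, e01, e10]
    linear_combination μ * (1 - μ * t * ν) * htr + μ ^ 2 * hdet - μ ^ 2 * ν ^ 2 * hD - (μ * t + μ ^ 2 * d * (1 + 2 * ν) - μ ^ 2 * t ^ 2 * ν) * hν
  refine ⟨htr', hdet', ?_⟩
  rw [htr', hdet']
  linear_combination ε₀ * μ ^ 2 * z ^ 2 * (2 * ν + 1) * hν

/-- **THE AFFINE IDENTITY FROM TWO DESCENTS**: if `D u D⁻¹ = s·ι(g)` and `D u′ D⁻¹ = s′·ι(1 + μ(g − ½t·1))` for `D = diag(1, α)`, then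
`u′ = s′·1 + (s′·ι μ·s⁻¹)·(u − (s·ι(t∕2))·1)`. [cite: LabesseLanglands1979, §2 p. 8] -/
theorem eq_smul_one_add_smul_of_descents {α : E} (hα0 : α ≠ 0) {u u' : Matrix (Fin 2) (Fin 2) E} {s s' : E} (hs : s ≠ 0)
    {g : Matrix (Fin 2) (Fin 2) F} {t μ : F}
    (hu : Matrix.diagonal ![1, α] * u * Matrix.diagonal ![1, α⁻¹] = s • g.map ι)
    (hu' : Matrix.diagonal ![1, α] * u' * Matrix.diagonal ![1, α⁻¹] = s' • (1 + μ • (g - (t / 2) • (1 : Matrix (Fin 2) (Fin 2) F))).map ι) :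
    u' = s' • (1 : Matrix (Fin 2) (Fin 2) E) + (s' * ι μ * s⁻¹) • (u - (s * ι (t / 2)) • (1 : Matrix (Fin 2) (Fin 2) E)) := by
  have hD := diagonal_inv_mul_diagonal (E := E) hα0
  have hD' := diagonal_mul_diagonal_inv (E := E) hα0
  have huv : u = Matrix.diagonal ![1, α⁻¹] * (s • g.map ι) * Matrix.diagonal ![1, α] := by
    rw [← hu]
    calc u = (Matrix.diagonal ![1, α⁻¹] * Matrix.diagonal ![1, α]) * u * (Matrix.diagonal ![1, α⁻¹] * Matrix.diagonal ![1, α]) := by rw [hD, Matrix.one_mul, Matrix.mul_one]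
      _ = _ := by simp only [Matrix.mul_assoc]
  have huv' : u' = Matrix.diagonal ![1, α⁻¹] * (s' • (1 + μ • (g - (t / 2) • (1 : Matrix (Fin 2) (Fin 2) F))).map ι) * Matrix.diagonal ![1, α] := by
    rw [← hu']
    calc u' = (Matrix.diagonal ![1, α⁻¹] * Matrix.diagonal ![1, α]) * u' * (Matrix.diagonal ![1, α⁻¹] * Matrix.diagonal ![1, α]) := by rw [hD, Matrix.one_mul, Matrix.mul_one]
      _ = _ := by simp only [Matrix.mul_assoc]
  rw [huv', huv]
  have hαα : α⁻¹ * α = 1 := inv_mul_cancel₀ hα0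
  have hss : s' * ι μ * s⁻¹ * s = s' * ι μ := by rw [mul_assoc, inv_mul_cancel₀ hs, mul_one]
  ext i j
  fin_cases i <;> fin_cases j <;>
    simp [Matrix.mul_apply, Matrix.diagonal, Matrix.one_apply, map_sub, map_mul, map_add, map_div₀, map_ofNat] <;>
    field_simp

/-- Trace and determinant of a descended element: `D u D⁻¹ = s·ι(g)` gives `tr u = s·ι(tr g)` and `det u = s²·ι(det g)`. [cite: Serre1980Trees, Ch. II §1.3] -/
theorem trace_and_det_of_descent {α : E} (hα0 : α ≠ 0) {u : Matrix (Fin 2) (Fin 2) E} {s : E} {g : Matrix (Fin 2) (Fin 2) F}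
    (hu : Matrix.diagonal ![1, α] * u * Matrix.diagonal ![1, α⁻¹] = s • g.map ι) :
    u.trace = s * ι g.trace ∧ u.det = s ^ 2 * ι g.det := by
  have hD := diagonal_inv_mul_diagonal (E := E) hα0
  have huv : u = Matrix.diagonal ![1, α⁻¹] * (s • g.map ι) * Matrix.diagonal ![1, α] := by
    rw [← hu]
    calc u = (Matrix.diagonal ![1, α⁻¹] * Matrix.diagonal ![1, α]) * u * (Matrix.diagonal ![1, α⁻¹] * Matrix.diagonal ![1, α]) := by rw [hD, Matrix.one_mul, Matrix.mul_one]
      _ = _ := by simp only [Matrix.mul_assoc]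
  have hαα : α * α⁻¹ = 1 := mul_inv_cancel₀ hα0
  rw [huv, Matrix.trace_fin_two, Matrix.det_fin_two, Matrix.trace_fin_two, Matrix.det_fin_two, map_add, map_sub, map_mul, map_mul]
  constructor
  · simp [Matrix.mul_apply, Matrix.diagonal]
    linear_combination (s * ι (g 1 1)) * hαα
  · simp [Matrix.mul_apply, Matrix.diagonal]
    linear_combination (s ^ 2 * ι (g 0 0) * ι (g 1 1) - s ^ 2 * ι (g 0 1) * ι (g 1 0)) * hαα

omit ι in
/-- Conjugation commutes with the affine expression: `P⁻¹ (a·1 + b·(u − c·1)) P = a·1 + b·(P⁻¹ u P − c·1)`. [cite: Rogawski1990, §4.9 p. 55] -/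
theorem conj_affine (P : GL (Fin 2) E) (u : Matrix (Fin 2) (Fin 2) E) (a b c : E) :
    ((P⁻¹ : GL (Fin 2) E) : Matrix (Fin 2) (Fin 2) E) * (a • (1 : Matrix (Fin 2) (Fin 2) E) + b • (u - c • (1 : Matrix (Fin 2) (Fin 2) E))) * (P : Matrix (Fin 2) (Fin 2) E) =
      a • (1 : Matrix (Fin 2) (Fin 2) E) + b • (((P⁻¹ : GL (Fin 2) E) : Matrix (Fin 2) (Fin 2) E) * u * (P : Matrix (Fin 2) (Fin 2) E) - c • (1 : Matrix (Fin 2) (Fin 2) E)) := by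
  have hP : ((P⁻¹ : GL (Fin 2) E) : Matrix (Fin 2) (Fin 2) E) * (P : Matrix (Fin 2) (Fin 2) E) = 1 := by
    rw [← Units.val_mul, inv_mul_cancel, Units.val_one]
  rw [Matrix.mul_add, Matrix.add_mul, Matrix.mul_smul, Matrix.smul_mul, Matrix.mul_one, hP, Matrix.mul_smul, Matrix.smul_mul, Matrix.mul_sub, Matrix.sub_mul,
    Matrix.mul_smul, Matrix.smul_mul, Matrix.mul_one, hP]

omit ι in
/-- **ROOTS TRANSPORT ALONG THE AFFINE MAP**: if `u′ = a·1 + b·(u − c·1)` with `b ≠ 0` and `χ_{u′}(x) = 0`, then `χ_u((x − a)∕b + c) = 0`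
(`χ_{u′}(x) = b²·χ_u((x − a)∕b + c)` for `2 × 2` matrices). [cite: Rogawski1990, §3.6 p. 31] -/
theorem isRoot_charpoly_of_affine {u u' : Matrix (Fin 2) (Fin 2) E} {a b c : E} (hb : b ≠ 0)
    (hu' : u' = a • (1 : Matrix (Fin 2) (Fin 2) E) + b • (u - c • (1 : Matrix (Fin 2) (Fin 2) E))) {x : E} (hx : u'.charpoly.IsRoot x) :
    u.charpoly.IsRoot ((x - a) / b + c) := by
  rw [Matrix.charpoly_fin_two, Polynomial.IsRoot.def] at hx ⊢
  simp only [eval_add, eval_sub, eval_mul, eval_pow, eval_C, eval_X] at hx ⊢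
  rw [hu', Matrix.trace_fin_two, Matrix.det_fin_two] at hx
  rw [Matrix.trace_fin_two, Matrix.det_fin_two]
  simp only [Matrix.add_apply, Matrix.smul_apply, Matrix.sub_apply, Matrix.one_apply_eq, Matrix.one_apply_ne (show (0 : Fin 2) ≠ 1 by decide),
    Matrix.one_apply_ne (show (1 : Fin 2) ≠ 0 by decide), smul_eq_mul, mul_one, mul_zero, sub_zero] at hx
  field_simp
  linear_combination hx

omit ι in
/-- **INTEGRALITY OF `s′·1 + k·N`**: for `|s′| ≤ 1` and `k ≠ 0`, every entry of `s′·1 + k·N` has `|·| ≤ 1` iff every entry of `N` has `|N_{ab}| ≤ |k|⁻¹`.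
[cite: Rogawski1990, §4.9 p. 55] -/
theorem forall_v_le_one_affine_iff [Valued E ℤᵐ⁰] {s' k : E} (hs' : Valued.v s' ≤ 1) (hk : k ≠ 0) (N : Matrix (Fin 2) (Fin 2) E) :
    (∀ a b : Fin 2, Valued.v ((s' • (1 : Matrix (Fin 2) (Fin 2) E) + k • N) a b) ≤ 1) ↔ ∀ a b : Fin 2, Valued.v (N a b) ≤ (Valued.v k)⁻¹ := by
  have hk0 : Valued.v k ≠ 0 := (Valuation.ne_zero_iff _).2 hk
  have hone : ∀ a b : Fin 2, Valued.v ((s' • (1 : Matrix (Fin 2) (Fin 2) E)) a b) ≤ 1 := by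
    intro a b
    rw [Matrix.smul_apply, smul_eq_mul]
    by_cases hab : a = b
    · rw [hab, Matrix.one_apply_eq, mul_one]; exact hs'
    · rw [Matrix.one_apply_ne hab, mul_zero, map_zero]; exact zero_le
  have hkey : ∀ a b : Fin 2, Valued.v (k * N a b) ≤ 1 ↔ Valued.v (N a b) ≤ (Valued.v k)⁻¹ := by
    intro a b
    rw [Valuation.map_mul, ← le_div_iff₀' (zero_lt_iff.2 hk0), one_div]
  constructor
  · intro h a b
    rw [← hkey]
    have e : k * N a b = (s' • (1 : Matrix (Fin 2) (Fin 2) E) + k • N) a b - (s' • (1 : Matrix (Fin 2) (Fin 2) E)) a b := by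
      simp only [Matrix.add_apply, Matrix.smul_apply, smul_eq_mul, add_sub_cancel_left]
    rw [e]
    exact (Valuation.map_sub _ _ _).trans (max_le (h a b) (hone a b))
  · intro h a b
    rw [Matrix.add_apply]
    refine (Valuation.map_add _ _ _).trans (max_le (hone a b) ?_)
    rw [Matrix.smul_apply, smul_eq_mul]
    exact (hkey a b).2 (h a b)

omit ι in
/-- A `2 × 2` matrix with `tr² − 4 det ≠ 0` has SEPARABLE characteristic polynomial (Bézout: `−4χ + (χ′)² = tr² − 4det`). [cite: Rogawski1990, §3.1 p. 19] -/
theorem charpoly_separable_of_disc_ne_zero (M : Matrix (Fin 2) (Fin 2) E) (h : M.trace ^ 2 - 4 * M.det ≠ 0) : M.charpoly.Separable := by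
  rw [Matrix.charpoly_fin_two]
  have hd : derivative (X ^ 2 - C M.trace * X + C M.det) = C (2 : E) * X - C M.trace := by
    simp only [derivative_add, derivative_sub, derivative_X_pow, derivative_mul, derivative_C, derivative_X, zero_mul, mul_one, zero_add, add_zero, map_ofNat, Nat.cast_ofNat]
    ring
  unfold Polynomial.Separable
  rw [hd]
  refine ⟨-4 * C (M.trace ^ 2 - 4 * M.det)⁻¹, C (M.trace ^ 2 - 4 * M.det)⁻¹ * (C (2 : E) * X - C M.trace), ?_⟩
  have key : (-4 : E[X]) * (X ^ 2 - C M.trace * X + C M.det) + (C (2 : E) * X - C M.trace) * (C (2 : E) * X - C M.trace) = C (M.trace ^ 2 - 4 * M.det) := by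
    simp only [map_sub, map_mul, map_pow, map_ofNat]
    ring
  calc -4 * C (M.trace ^ 2 - 4 * M.det)⁻¹ * (X ^ 2 - C M.trace * X + C M.det) + C (M.trace ^ 2 - 4 * M.det)⁻¹ * (C (2 : E) * X - C M.trace) * (C (2 : E) * X - C M.trace)
      = C (M.trace ^ 2 - 4 * M.det)⁻¹ * ((-4 : E[X]) * (X ^ 2 - C M.trace * X + C M.det) + (C (2 : E) * X - C M.trace) * (C (2 : E) * X - C M.trace)) := by ring
    _ = 1 := by rw [key, ← map_mul, inv_mul_cancel₀ h, map_one]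

end Algebra

/-! ## §2 The rescaled unitary element `γ^{(j)}` at the place `w` -/

section Place

variable (L : Type) [Field L] [NumberField L] [IsCMField L] (v : HeightOneSpectrum (𝓞 ↥(maximalRealSubfield L)))
  (w : PlacesOver L v) (hw : IsCMField.complexConj L • w.1 = w.1)

include hw in
/-- **THE RESCALED ELEMENT `γ^{(j)}` (elliptic descent of either parity, `j ≤ n`)**.  Let `u ∈ U(σ_w, Φ₂)(L_w)` descend as `D_ϖ u D_ϖ⁻¹ = s·ι(g)` with `tr g = t ≠ 0`,
`tr²g − 4 det g = ε₀z²` (`z ≠ 0`; `ε₀` a non-square unit — even depth — or a uniformiser `π₁` — odd depth), `|z∕t| = |ϖ_F|ⁿ`, `j ≤ n` and `|ε₀|·|ϖ_F|^(2(n−j)) < 1` (i.e. `j < n` in the unit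
case).  With `μ := 2(ϖ_F^j)⁻¹t⁻¹` there are `u′ ∈ U(σ_w, Φ₂)(L_w)`, `s′ ∈ L_w`,
`g′ ∈ GL₂(L⁺_v)` such that: `D_ϖ u′ D_ϖ⁻¹ = s′·ι(g′)` (`s′ ≠ 0`), `tr g′ = 2`, `tr²g′ − 4det g′ = ε₀(μz)²` with `μz ≠ 0` and `|μz∕2| = |ϖ_F|^(n−j)` (the unramified-elliptic datum
at depth `2·2(n−j)`), `|s′| ≤ 1`, `|2s′ − 2| < 1` (deepness of `tr u′ = 2s′`), the AFFINE IDENTITY `u′ = s′·1 + (s′ιμ s⁻¹)·(u − sι(t∕2)·1)`, and `|s′ιμ s⁻¹|⁻¹ = |ϖ|^(2j)`.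
Construction: `g′ = 1 + μ(g − ½t)` (§1), `det g′ = λ²` with `λ` a one-unit of `L⁺_v` (Hensel), `s′ = ι(λ)⁻¹`, `u′ = D_ϖ⁻¹(s′ιg′)D_ϖ` (★ unitary lift); `|sιt| = |2|` from
`|det u| = 1`. [cite: LabesseLanglands1979, §2 Lemma 2.1 p. 8] [cite: Serre1979, Ch. II §4 Prop. 7] -/
theorem exists_rescaled_descent_of_elliptic (he : v.asIdeal.ramificationIdx' w.1.asIdeal ≠ 1)
    (ϖ : (w.1.adicCompletion L)ˣ) (hϖ : Valued.v (ϖ : (w.1.adicCompletion L)) = WithZero.exp (-1 : ℤ))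
    (hσϖ : galAdicCompletionMap (L := L) (IsCMField.complexConj L) hw (ϖ : (w.1.adicCompletion L)) = -(ϖ : (w.1.adicCompletion L)))
    {ϖF : v.adicCompletion ↥(maximalRealSubfield L)} (hϖF : Valued.v ϖF = WithZero.exp (-1 : ℤ))
    (h2v : Valued.v (2 : v.adicCompletion ↥(maximalRealSubfield L)) = 1)
    (u : ↥(unitaryGroupOfForm (galAdicCompletionMap (L := L) (IsCMField.complexConj L) hw)
      (placeForm (Matrix.of fun i j : Fin 2 => if i.val + j.val + 1 = 2 then (1 : L) else 0) w.1)))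
    {s : w.1.adicCompletion L} {g : GL (Fin 2) (v.adicCompletion ↥(maximalRealSubfield L))} (hs : s ≠ 0)
    (hsg : Matrix.diagonal ![1, (ϖ : w.1.adicCompletion L)] * ((u : GL (Fin 2) (w.1.adicCompletion L)) : Matrix (Fin 2) (Fin 2) (w.1.adicCompletion L)) *
      Matrix.diagonal ![1, (ϖ : w.1.adicCompletion L)⁻¹] = s • (g : Matrix (Fin 2) (Fin 2) (v.adicCompletion ↥(maximalRealSubfield L))).map (toPlace v w))
    {ε₀ : v.adicCompletion ↥(maximalRealSubfield L)} {t d z : v.adicCompletion ↥(maximalRealSubfield L)}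
    (htr : (g : Matrix (Fin 2) (Fin 2) (v.adicCompletion ↥(maximalRealSubfield L))).trace = t) (hdet : (g : Matrix (Fin 2) (Fin 2) (v.adicCompletion ↥(maximalRealSubfield L))).det = d)
    (ht : t ≠ 0) (hz : z ≠ 0) (hD : t ^ 2 - 4 * d = ε₀ * z ^ 2) {n : ℕ}
    (hn : valuation (v.adicCompletion ↥(maximalRealSubfield L)) (z * t⁻¹) = valuation (v.adicCompletion ↥(maximalRealSubfield L)) ϖF ^ n) {j : ℕ} (hjn : j ≤ n)
    (hεn : Valued.v ε₀ * Valued.v ϖF ^ (2 * (n - j)) < 1) :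
    ∃ (u' : ↥(unitaryGroupOfForm (galAdicCompletionMap (L := L) (IsCMField.complexConj L) hw)
        (placeForm (Matrix.of fun i j : Fin 2 => if i.val + j.val + 1 = 2 then (1 : L) else 0) w.1)))
      (s' : w.1.adicCompletion L) (g' : GL (Fin 2) (v.adicCompletion ↥(maximalRealSubfield L))),
      s' ≠ 0 ∧
      Matrix.diagonal ![1, (ϖ : w.1.adicCompletion L)] * ((u' : GL (Fin 2) (w.1.adicCompletion L)) : Matrix (Fin 2) (Fin 2) (w.1.adicCompletion L)) *
        Matrix.diagonal ![1, (ϖ : w.1.adicCompletion L)⁻¹] = s' • (g' : Matrix (Fin 2) (Fin 2) (v.adicCompletion ↥(maximalRealSubfield L))).map (toPlace v w) ∧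
      (g' : Matrix (Fin 2) (Fin 2) (v.adicCompletion ↥(maximalRealSubfield L))).trace = 2 ∧
      2 * (ϖF ^ j)⁻¹ * t⁻¹ * z ≠ 0 ∧
      (g' : Matrix (Fin 2) (Fin 2) (v.adicCompletion ↥(maximalRealSubfield L))).trace ^ 2 - 4 * (g' : Matrix (Fin 2) (Fin 2) (v.adicCompletion ↥(maximalRealSubfield L))).det =
        ε₀ * (2 * (ϖF ^ j)⁻¹ * t⁻¹ * z) ^ 2 ∧
      valuation (v.adicCompletion ↥(maximalRealSubfield L)) (2 * (ϖF ^ j)⁻¹ * t⁻¹ * z * (2 : v.adicCompletion ↥(maximalRealSubfield L))⁻¹) =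
        valuation (v.adicCompletion ↥(maximalRealSubfield L)) ϖF ^ (n - j) ∧
      Valued.v s' ≤ 1 ∧ Valued.v (2 * s' - 2) < 1 ∧
      ((u' : GL (Fin 2) (w.1.adicCompletion L)) : Matrix (Fin 2) (Fin 2) (w.1.adicCompletion L)) =
        s' • (1 : Matrix (Fin 2) (Fin 2) (w.1.adicCompletion L)) +
          (s' * toPlace v w (2 * (ϖF ^ j)⁻¹ * t⁻¹) * s⁻¹) • (((u : GL (Fin 2) (w.1.adicCompletion L)) : Matrix (Fin 2) (Fin 2) (w.1.adicCompletion L)) -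
            (s * toPlace v w (t / 2)) • (1 : Matrix (Fin 2) (Fin 2) (w.1.adicCompletion L))) ∧
      s' * toPlace v w (2 * (ϖF ^ j)⁻¹ * t⁻¹) * s⁻¹ ≠ 0 ∧
      (Valued.v (s' * toPlace v w (2 * (ϖF ^ j)⁻¹ * t⁻¹) * s⁻¹))⁻¹ = Valued.v (ϖ : w.1.adicCompletion L) ^ (2 * j) := by
  have hϖ0 : (ϖ : (w.1.adicCompletion L)) ≠ 0 := ϖ.ne_zero
  have h2v0 : (2 : v.adicCompletion ↥(maximalRealSubfield L)) ≠ 0 := fun h0 => zero_ne_one (by rw [h0, map_zero] at h2v; exact h2v)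
  have hϖF0 : ϖF ≠ 0 := fun h0 => by rw [h0, map_zero] at hϖF; exact WithZero.coe_ne_zero hϖF.symm
  have hϖF1 : Valued.v ϖF < 1 := by rw [hϖF, ← WithZero.exp_zero, WithZero.exp_lt_exp]; norm_num
  have hσι : ∀ x, galAdicCompletionMap (L := L) (IsCMField.complexConj L) hw (toPlace v w x) = toPlace v w x :=
    fun x => galAdicCompletionMap_toPlace (IsCMField.complexConj L) w w hw x
  -- the rescaled datum `g′ = 1 + μ(g − ½t)`
  set μ : v.adicCompletion ↥(maximalRealSubfield L) := 2 * (ϖF ^ j)⁻¹ * t⁻¹ with hμ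
  have hμ0 : μ ≠ 0 := mul_ne_zero (mul_ne_zero h2v0 (inv_ne_zero (pow_ne_zero _ hϖF0))) (inv_ne_zero ht)
  obtain ⟨htr', hdet', hdisc'⟩ := trace_det_disc_one_add_smul_sub h2v0 (g : Matrix (Fin 2) (Fin 2) (v.adicCompletion ↥(maximalRealSubfield L))) htr hdet hD μ
  -- `|μz∕2| = |ϖ_F|^(n−j) < 1`
  have hval : Valued.v (μ * z / 2) = Valued.v ϖF ^ (n - j) := by
    have hn' : Valued.v (z * t⁻¹) = Valued.v ϖF ^ n := by
      rw [← map_pow] at hn ⊢; exact (v_eq_iff_valuation_eq _ _).2 hn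
    have e : μ * z / 2 = (ϖF ^ j)⁻¹ * (z * t⁻¹) := by rw [hμ]; field_simp
    rw [e, Valuation.map_mul, map_inv₀, Valuation.map_pow, hn', pow_sub₀ _ ((Valuation.ne_zero_iff _).2 hϖF0) hjn, mul_comm]
  -- `ν = det g′` is a one-unit, `ν = λ²`
  have hν1 : Valued.v ((1 + μ • ((g : Matrix (Fin 2) (Fin 2) (v.adicCompletion ↥(maximalRealSubfield L))) - (t / 2) • 1)).det - 1) < 1 := by
    rw [hdet', show (1 : v.adicCompletion ↥(maximalRealSubfield L)) - ε₀ * (μ * z / 2) ^ 2 - 1 = -(ε₀ * (μ * z / 2) ^ 2) by ring, Valuation.map_neg, Valuation.map_mul,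
      Valuation.map_pow, hval, ← pow_mul, mul_comm (n - j) 2]
    exact hεn
  obtain ⟨lam, hlam2, hlam1⟩ := exists_sq_eq_of_valued_sub_one_lt v h2v _ hν1
  have hlamv : Valued.v lam = 1 := by
    have e : lam = 1 + (lam - 1) := by ring
    rw [e]; exact Valuation.map_one_add_of_lt _ hlam1
  have hlam0 : lam ≠ 0 := fun h0 => by rw [h0, map_zero] at hlamv; exact zero_ne_one hlamv
  have hdet0 : (1 + μ • ((g : Matrix (Fin 2) (Fin 2) (v.adicCompletion ↥(maximalRealSubfield L))) - (t / 2) • 1)).det ≠ 0 := by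
    rw [← hlam2]; exact pow_ne_zero _ hlam0
  set g' : GL (Fin 2) (v.adicCompletion ↥(maximalRealSubfield L)) := Matrix.GeneralLinearGroup.mk'' _ (isUnit_iff_ne_zero.2 hdet0) with hg'
  have hg'coe : (g' : Matrix (Fin 2) (Fin 2) (v.adicCompletion ↥(maximalRealSubfield L))) = 1 + μ • ((g : Matrix (Fin 2) (Fin 2) (v.adicCompletion ↥(maximalRealSubfield L))) - (t / 2) • 1) := rfl
  -- the unitary lift with `s′ = ι(λ)⁻¹`
  set s' : w.1.adicCompletion L := (toPlace v w lam)⁻¹ with hs'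
  have hιlam0 : toPlace v w lam ≠ 0 := by rw [_root_.map_ne_zero]; exact hlam0
  have hs'0 : s' ≠ 0 := inv_ne_zero hιlam0
  have hnorm : galAdicCompletionMap (L := L) (IsCMField.complexConj L) hw s' * s' * toPlace v w (g' : Matrix (Fin 2) (Fin 2) (v.adicCompletion ↥(maximalRealSubfield L))).det = 1 := by
    rw [hs', map_inv₀, hσι, hg'coe, ← hlam2, map_pow]
    field_simp
  obtain ⟨u₀, hu₀⟩ := exists_mem_unitaryGroupOfForm_conj_eq_smul_map (toPlace v w) (galAdicCompletionMap (L := L) (IsCMField.complexConj L) hw) hσι hσϖ hϖ0 hnorm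
  have hu₀mem : (u₀ : GL (Fin 2) (w.1.adicCompletion L)) ∈ unitaryGroupOfForm (galAdicCompletionMap (L := L) (IsCMField.complexConj L) hw)
      (placeForm (Matrix.of fun i j : Fin 2 => if i.val + j.val + 1 = 2 then (1 : L) else 0) w.1) := by
    rw [unitaryGroupOfForm_placeForm_antidiagTwo_eq]; exact u₀.2
  -- valuations: `|s′| = 1`, `|2s′ − 2| < 1`, `|s ι t| = |2|`, `|k|⁻¹ = |ϖ|^(2j)`
  have hιlamv : Valued.v (toPlace v w lam) = 1 := by rw [valued_toPlace_eq_sq_of_ramified L v w hw he, hlamv, one_pow]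
  have hs'v : Valued.v s' = 1 := by rw [hs', map_inv₀, hιlamv, inv_one]
  obtain ⟨h2w, -⟩ := valued_two_eq_one_of_ramified L v w hw he h2v
  have htr2 : Valued.v (2 * s' - 2) < 1 := by
    have e : 2 * s' - 2 = 2 * s' * toPlace v w (1 - lam) := by
      rw [map_sub, map_one, hs']; field_simp
    rw [e, Valuation.map_mul, Valuation.map_mul, h2w, hs'v, one_mul, one_mul, valued_toPlace_eq_sq_of_ramified L v w hw he, ← Valuation.map_neg, neg_sub]
    exact pow_lt_one₀ zero_le hlam1 two_ne_zero
  -- `|s ι t| = |2|`: `det u = s² ι(d)` has `|·| = 1` and `4d = t²(1 − ε₀(z∕t)²)`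
  have hdetu : ((u : GL (Fin 2) (w.1.adicCompletion L)) : Matrix (Fin 2) (Fin 2) (w.1.adicCompletion L)).det = s ^ 2 * toPlace v w d := by
    have h := congrArg Matrix.det hsg
    rw [Matrix.det_mul, Matrix.det_mul, Matrix.det_smul, Fintype.card_fin, ← RingHom.mapMatrix_apply, ← RingHom.map_det, hdet] at h
    have hDD : (Matrix.diagonal ![(1 : w.1.adicCompletion L), (ϖ : w.1.adicCompletion L)]).det * (Matrix.diagonal ![(1 : w.1.adicCompletion L), (ϖ : w.1.adicCompletion L)⁻¹]).det = 1 := by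
      rw [Matrix.det_diagonal, Matrix.det_diagonal]; simp [Fin.prod_univ_two]
    calc ((u : GL (Fin 2) (w.1.adicCompletion L)) : Matrix (Fin 2) (Fin 2) (w.1.adicCompletion L)).det
        = (Matrix.diagonal ![(1 : w.1.adicCompletion L), (ϖ : w.1.adicCompletion L)]).det * ((u : GL (Fin 2) (w.1.adicCompletion L)) : Matrix (Fin 2) (Fin 2) (w.1.adicCompletion L)).det *
            (Matrix.diagonal ![(1 : w.1.adicCompletion L), (ϖ : w.1.adicCompletion L)⁻¹]).det := by
          rw [mul_comm (Matrix.det _) (Matrix.det _), mul_assoc, hDD, mul_one]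
      _ = s ^ 2 * toPlace v w d := h
  have hzt : Valued.v (z * t⁻¹) ≤ 1 := by
    have hn' : Valued.v (z * t⁻¹) = Valued.v ϖF ^ n := by rw [← map_pow] at hn ⊢; exact (v_eq_iff_valuation_eq _ _).2 hn
    rw [hn']; exact pow_le_one₀ zero_le hϖF1.le
  have hzt1 : Valued.v (ε₀ * (z * t⁻¹) ^ 2) < 1 := by
    have hn' : Valued.v (z * t⁻¹) = Valued.v ϖF ^ n := by rw [← map_pow] at hn ⊢; exact (v_eq_iff_valuation_eq _ _).2 hn
    rw [Valuation.map_mul, Valuation.map_pow, hn', ← pow_mul]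
    calc Valued.v ε₀ * Valued.v ϖF ^ (n * 2) ≤ Valued.v ε₀ * Valued.v ϖF ^ (2 * (n - j)) :=
          mul_le_mul_right (pow_le_pow_right_of_le_one' hϖF1.le (by omega)) _
      _ < 1 := hεn
  have hunit : Valued.v (1 - ε₀ * (z * t⁻¹) ^ 2) = 1 := by
    rw [sub_eq_add_neg]; exact Valuation.map_one_add_of_lt _ (by rw [Valuation.map_neg]; exact hzt1)
  have hst : Valued.v (s * toPlace v w t) = Valued.v (2 : w.1.adicCompletion L) := by
    apply eq_of_sq_eq_sq
    have hdu : Valued.v (((u : GL (Fin 2) (w.1.adicCompletion L)) : Matrix (Fin 2) (Fin 2) (w.1.adicCompletion L)).det) = 1 := v_det_coe_eq_one_of_mem_placeForm L w hw u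
    have htt : t * t⁻¹ = 1 := mul_inv_cancel₀ ht
    have e4d : (4 : v.adicCompletion ↥(maximalRealSubfield L)) * d = t ^ 2 * (1 - ε₀ * (z * t⁻¹) ^ 2) := by
      linear_combination (-1 : v.adicCompletion ↥(maximalRealSubfield L)) * hD + ε₀ * z ^ 2 * (t * t⁻¹ + 1) * htt
    have e : (s * toPlace v w t) ^ 2 = (2 : w.1.adicCompletion L) ^ 2 * (s ^ 2 * toPlace v w d) * (toPlace v w (1 - ε₀ * (z * t⁻¹) ^ 2))⁻¹ := by
      have h1 : toPlace v w (1 - ε₀ * (z * t⁻¹) ^ 2) ≠ 0 := by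
        rw [_root_.map_ne_zero]; intro h0; rw [h0, map_zero] at hunit; exact zero_ne_one hunit
      have h4 : toPlace v w (4 * d) = toPlace v w (t ^ 2 * (1 - ε₀ * (z * t⁻¹) ^ 2)) := by rw [e4d]
      rw [map_mul, map_mul, map_pow, map_ofNat] at h4
      have hW : (toPlace v w t) ^ 2 = 4 * toPlace v w d * (toPlace v w (1 - ε₀ * (z * t⁻¹) ^ 2))⁻¹ := by
        rw [eq_mul_inv_iff_mul_eq₀ h1]; exact h4.symm
      calc (s * toPlace v w t) ^ 2 = s ^ 2 * (toPlace v w t) ^ 2 := by ring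
        _ = s ^ 2 * (4 * toPlace v w d * (toPlace v w (1 - ε₀ * (z * t⁻¹) ^ 2))⁻¹) := by rw [hW]
        _ = (2 : w.1.adicCompletion L) ^ 2 * (s ^ 2 * toPlace v w d) * (toPlace v w (1 - ε₀ * (z * t⁻¹) ^ 2))⁻¹ := by ring
    rw [← Valuation.map_pow, ← Valuation.map_pow, e, Valuation.map_mul, Valuation.map_mul, map_inv₀, valued_toPlace_eq_sq_of_ramified L v w hw he (1 - _), hunit, one_pow,
      inv_one, mul_one, ← hdetu, hdu, mul_one]
  have hk0 : s' * toPlace v w μ * s⁻¹ ≠ 0 := mul_ne_zero (mul_ne_zero hs'0 (by rw [_root_.map_ne_zero]; exact hμ0)) (inv_ne_zero hs)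
  have hkv : (Valued.v (s' * toPlace v w μ * s⁻¹))⁻¹ = Valued.v (ϖ : w.1.adicCompletion L) ^ (2 * j) := by
    have hιt0 : toPlace v w t ≠ 0 := by rw [_root_.map_ne_zero]; exact ht
    have h20 : Valued.v (2 : w.1.adicCompletion L) ≠ 0 := by rw [h2w]; exact one_ne_zero
    have e : s' * toPlace v w μ * s⁻¹ = s' * 2 * ((toPlace v w ϖF) ^ j)⁻¹ * (s * toPlace v w t)⁻¹ := by
      rw [hμ, map_mul, map_mul, map_inv₀, map_inv₀, map_pow, map_ofNat]; field_simp
    rw [e, Valuation.map_mul, Valuation.map_mul, Valuation.map_mul, hs'v, h2w, map_inv₀, map_inv₀, hst, h2w, Valuation.map_pow,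
      valued_toPlace_eq_sq_of_ramified L v w hw he, hϖF, hϖ, one_mul, one_mul, inv_one, mul_one, inv_inv, ← pow_mul]
  refine ⟨⟨(u₀ : GL (Fin 2) (w.1.adicCompletion L)), hu₀mem⟩, s', g', hs'0, hu₀, htr', mul_ne_zero hμ0 hz, ?_, ?_, hs'v.le, htr2, ?_, hk0, hkv⟩
  · rw [hg'coe, hdisc']
  · rw [← map_pow, show μ * z * (2 : v.adicCompletion ↥(maximalRealSubfield L))⁻¹ = μ * z / 2 from (div_eq_mul_inv _ _).symm]
    exact (v_eq_iff_valuation_eq _ _).1 (by rw [map_pow]; exact hval)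
  · exact eq_smul_one_add_smul_of_descents (toPlace v w) hϖ0 hs hsg (by rw [hu₀, hg'coe])

end Place

end Literature.NumberTheory.Automorphic.UnitaryGroup

end
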